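import Summits.ResolutionOfSingularities.ResolutionOfSingularities.Theorems.PurelyInseparableDim4ResConePowerChainTilt
import Summits.ResolutionOfSingularities.ResolutionOfSingularities.Theorems.PurelyInseparableDim4ResConeShearTransport
import Summits.ResolutionOfSingularities.ResolutionOfSingularities.Theorems.PurelyInseparableDim4ResConeLightTripleMinor
import HarnessLib

/-!
# Purely inseparable four-folds — C∞ PINNING, free half: along the C∞ tail the free letter `u` is never
# translated (K24b-FRAME, file F1 part (VT-u): cell `res-dim4-pi`, K2(p) lane, slice B)

[OURS · counted 0 · cell `res-dim4-pi` · K2(p) lane holder res-dim4-p-12 g3's split of K24b by file (bus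
2026-08-29 02:23:39Z): F1 = res-dim4-typ-1 g2 ((P) `…ResConeCInfNormalForm`, (VT-f) `…ResConeCInfPinning`),
its remainder (VT-u) inherited by res-dim4-p-2 g4 (this file); spec res-dim4-idea-4 g3 HANDOFF-g3 §11 ((VT)
«vertex translation is zero in the normal form»); hand derivation res-dim4-typ-1 g2 HANDOFF § «(VT) PINNING».]
Nothing here proves K2(p)/K2(5), `NoIsolatedTrap 5 5` or resolution of singularities in dimension ≥ 4 /
characteristic `p` — NOT proved.  AI kernel work, weaker than expert review.

**`cInf_translation_u_eq_zero`** (over the PowerChain frame of `…ResConePowerChainTilt`): on a shade-`4`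
stretch, at a stage `k` with chart `j_k = λ`, STRAIGHT vertex form (`ℓ_k = ℓ_f e_f`), `b_k μ = 0` (kept weight)
and `b_k f = 0` (the contact half, `cInf_translation_contact_eq_zero`), the dead `ū²`-row entry
`coeff (r + 2λ + μ + 2u) F_k = 0`, the `u`-axis flag `V(0) = coeff (r + λ + μ + 3u) F_k ≠ 0` and the pair-ledger
reading `coeff (r + μ + 4u) F_k = 0` force `b_k u = 0`.  Proof: the tilt identity `chain_tilt_identity` at the
`x_λ`-free cubic `x_μ u²` has left side `0` (a straight form cubed has no `x_μ u²`), so the coefficient of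
`x_λ² x_μ u²` in `shear_λ^{b_k} G_k` vanishes; `b_k = b_k u · e_u`, and by the single-letter coefficient law
`coeff_shear_single` (res-dim4-p-5 g3's `…ResConeShearTransport`, TREE FIRST — pointer res-dim4-typ-1 g3) that
coefficient is `0 + 3·b_k u·V(0) + 6·(b_k u)²·0`; `3 ≠ 0` because `4 < p`.  With (VT-f) this is idea-4's (VT):
the C∞ tail is translation-free in the letters `μ, u, f`.
bears_on: LADDER-RESOLUTION:D157-DOOR2 (res-dim4-pi · K2(p) · slice B · K24b-FRAME F1 (VT-u)).  Supports
stmt-ResolutionOfSingularities-16155 (helper).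
-/

set_option linter.dupNamespace false -- mandated namespace of this single-conjunct summit

namespace Summit.ResolutionOfSingularities.ResolutionOfSingularities.Theorems.PIDim4

namespace ResCone

open MvPolynomial Finset
open Literature.AlgebraicGeometry.Resolution
open Literature.AlgebraicGeometry.Resolution.CentreBlowup
open Literature.AlgebraicGeometry.Resolution.Hauser2010
open Literature.AlgebraicGeometry.Resolution.HauserPerlega2019

variable {K : Type} [Field K]

/-! ## The `u`-half of (VT): the free letter `u` is never translated along the C∞ tail -/

section Chain

variable (p : ℕ) [hp : Fact p.Prime] [CharP K p] [DecidableEq K]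

/-- **(VT-u) PINNING** (K24b-FRAME F1, the `u`-half of idea-4's (VT); chain form over the PowerChain frame data):
on a shade-`4` stretch, at a stage `k` whose vertex form is STRAIGHT (`ℓ_k = ℓ_f e_f`), with chart `j_k = λ`,
`μ` and `f` untranslated (`b_k μ = 0` kept weight, `b_k f = 0` = the contact half
`cInf_translation_contact_eq_zero`), the dead `ū²`-row entry `coeff (r + 2λ + μ + 2u) F = 0`, the `u`-axis flag
`V(0) = coeff (r + λ + μ + 3u) F ≠ 0` and the pair-ledger reading `coeff (r + μ + 4u) F = 0`: the translation
`b_k u` VANISHES.  Proof: the tilt identity (`chain_tilt_identity`) at the `x_λ`-free cubic `x_μ u²` has left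
side `0` (the straight form has no `x_μ u²`), so `coeff_{2λ+μ+2u} (shear_λ^{b_k} G_k) = 0`; by
`coeff_shear_single` this coefficient is `0 + 3·b_k u·V(0) + 6·(b_k u)²·0`; `3 ≠ 0` (`4 < p`). [OURS]
[cite: CossartJannsenSaito2020, Thm. 3.10(4), Thm. 9.3] -/
theorem cInf_translation_u_eq_zero {c : ℕ → State K} {j : ℕ → Fin 4} {b : ℕ → Fin 4 → K}
    (hc : ∀ k, IsIsolated p (c k).F ∧ Step0 p (c k) (c (k + 1))) (hw : FreeTail.IsWitnessedChain p c j b)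
    (hr0 : ∀ e ∈ (c 0).F.support, (c 0).r ≤ e) (hfloor : ∀ k, ordZero (c k).F ≠ p) (hdp : 4 < p) {k₀ : ℕ}
    (hshade : ∀ k, k₀ ≤ k → (c k).shade = ((4 : ℕ) : ℕ∞)) {k : ℕ} (hk : k₀ ≤ k) {ℓ ℓ' : Fin 4 → K}
    {a₀' lam' : K} (hform' : resForm (c (k + 1)) = C a₀' * (∑ i, C (ℓ' i) * X i) ^ 4)
    (hlam : ∀ i, i ≠ j k → ℓ' i = lam' * ℓ i) {lamL mu u f : Fin 4} (hjl : j k = lamL) (hml : mu ≠ lamL)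
    (hul : u ≠ lamL) (hfl : f ≠ lamL) (hmu : mu ≠ u) (hfu : f ≠ u) (hfm : f ≠ mu)
    (hstraight : ∀ i, i ≠ f → ℓ i = 0) (hbm : b k mu = 0) (hbf : b k f = 0)
    (hnf : coeff ((c k).r + (Finsupp.single lamL 2 + Finsupp.single mu 1 + Finsupp.single u 2)) (c k).F = 0)
    (hV : coeff ((c k).r + (Finsupp.single lamL 1 + Finsupp.single mu 1 + Finsupp.single u 3)) (c k).F ≠ 0)
    (hW : coeff ((c k).r + (Finsupp.single mu 1 + Finsupp.single u 4)) (c k).F = 0) : b k u = 0 := by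
  classical
  subst hjl
  have hbj : b k (j k) = 0 := (hw k).2.1
  have hcov : ∀ i : Fin 4, i = j k ∨ i = mu ∨ i = u ∨ i = f := fun i => by
    have h1 := Finset.mem_univ i
    rw [univ_eq_of_four hml.symm hul.symm hfl.symm hmu hfm.symm (Ne.symm hfu)] at h1
    simpa [Finset.mem_insert, Finset.mem_singleton] using h1
  -- (1) the tilt identity at the `x_λ`-free cubic `x_μ u²`
  set μ₀ : Fin 4 →₀ ℕ := Finsupp.single mu 1 + Finsupp.single u 2 with hμ₀
  have hμ₀j : μ₀ (j k) = 0 := by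
    rw [hμ₀, Finsupp.add_apply, Finsupp.single_eq_of_ne (Ne.symm hml), Finsupp.single_eq_of_ne (Ne.symm hul), add_zero]
  have hμ₀deg : μ₀.degree + 1 = 4 := by rw [hμ₀, map_add, Finsupp.degree_single, Finsupp.degree_single]
  have htilt := chain_tilt_identity p hc hw hr0 hfloor hshade hk hform' hlam hμ₀j hμ₀deg
  -- the straight form has no `x_μ u²`
  have hform0 : (∑ i, C (Function.update ℓ (j k) 0 i) * X i : MvPolynomial (Fin 4) K) = C (ℓ f) * X f := by
    rw [Finset.sum_eq_single f]
    · rw [Function.update_of_ne (Ne.symm hfl.symm)]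
    · intro i _ hif
      by_cases hij : i = j k
      · rw [hij, Function.update_self, C_0, zero_mul]
      · rw [Function.update_of_ne hij, hstraight i hif, C_0, zero_mul]
    · intro h; exact absurd (Finset.mem_univ f) h
  have hcoef0 : coeff μ₀ ((∑ i, C (Function.update ℓ (j k) 0 i) * X i : MvPolynomial (Fin 4) K) ^ (4 - 1)) = 0 := by
    rw [hform0, mul_pow, ← C_pow, X_pow_eq_monomial, C_mul_monomial, coeff_monomial, if_neg]
    intro h
    have h1 := DFunLike.congr_fun h u
    simp [hμ₀, Ne.symm hfu, hmu] at h1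
  rw [hcoef0, mul_zero] at htilt
  -- hence the birth coefficient vanishes
  have hbirth : coeff (μ₀ + Finsupp.single (j k) 2) (shear (j k) (b k) ((c k).F.divMonomial (c k).r)) = 0 := by
    have hc0 := coeff_topMonomial_ne_zero (j k) hbj (c k).r
    rcases mul_eq_zero.mp htilt.symm with h | h
    · exact absurd h hc0
    · exact h
  -- (2) the translation vector is supported on `u`
  have hb : ∀ i, i ≠ u → b k i = 0 := by
    intro i hi
    rcases hcov i with h1 | h1 | h1 | h1
    · rw [h1]; exact hbj
    · rw [h1]; exact hbm
    · exact absurd h1 hi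
    · rw [h1]; exact hbf
  -- (3) read the birth coefficient through the one-letter shear: `0 + 3·β·V(0) + 6·β²·0`
  have hbs : b k = Pi.single u (b k u) := by
    funext i
    by_cases hiu : i = u
    · rw [hiu, Pi.single_eq_same]
    · rw [Pi.single_eq_of_ne hiu, hb i hiu]
  rw [hbs, coeff_shear_single (Ne.symm hul) (b k u)] at hbirth
  have hej : (μ₀ + Finsupp.single (j k) 2 : Fin 4 →₀ ℕ) (j k) = 2 := by
    rw [Finsupp.add_apply, hμ₀j, Finsupp.single_eq_same]
  have heu : (μ₀ + Finsupp.single (j k) 2 : Fin 4 →₀ ℕ) u = 2 := by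
    rw [Finsupp.add_apply, hμ₀, Finsupp.add_apply, Finsupp.single_eq_of_ne (Ne.symm hmu), Finsupp.single_eq_same,
      Finsupp.single_eq_of_ne hul]
    try omega
  rw [hej, heu, Finset.sum_range_succ, Finset.sum_range_succ, Finset.sum_range_succ, Finset.sum_range_zero,
    zero_add] at hbirth
  -- the three exponents, in `F`-coordinates
  have hupd : ∀ x y x' y' : ℕ, x = x' → y = y' →
      ((μ₀ + Finsupp.single (j k) 2).update (j k) x).update u y =
        Finsupp.single (j k) x' + Finsupp.single mu 1 + Finsupp.single u y' := by
    intro x y x' y' hx hy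
    subst hx; subst hy
    ext i
    simp only [Finsupp.coe_update, Finsupp.add_apply, hμ₀]
    rcases hcov i with h | h | h | h <;> rw [h]
    · rw [Function.update_of_ne (Ne.symm hul), Function.update_self, Finsupp.single_eq_same,
        Finsupp.single_eq_of_ne hml.symm, Finsupp.single_eq_of_ne hul.symm]
      omega
    · rw [Function.update_of_ne hmu, Function.update_of_ne hml, Finsupp.add_apply, Finsupp.add_apply,
        Finsupp.single_eq_same, Finsupp.single_eq_of_ne hmu, Finsupp.single_eq_of_ne hml,
        Finsupp.single_eq_of_ne hml, Finsupp.single_eq_of_ne hmu]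
      omega
    · rw [Function.update_self, Finsupp.single_eq_of_ne hul, Finsupp.single_eq_of_ne (Ne.symm hmu),
        Finsupp.single_eq_same]
      omega
    · rw [Function.update_of_ne hfu, Function.update_of_ne hfl, Finsupp.add_apply, Finsupp.add_apply,
        Finsupp.single_eq_of_ne hfm, Finsupp.single_eq_of_ne hfu, Finsupp.single_eq_of_ne hfl,
        Finsupp.single_eq_of_ne hfl, Finsupp.single_eq_of_ne hfu]
  have he0 : ((μ₀ + Finsupp.single (j k) 2).update (j k) (2 - 0)).update u (2 + 0) =
      Finsupp.single (j k) 2 + Finsupp.single mu 1 + Finsupp.single u 2 := hupd _ _ 2 2 rfl rfl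
  have he1 : ((μ₀ + Finsupp.single (j k) 2).update (j k) (2 - 1)).update u (2 + 1) =
      Finsupp.single (j k) 1 + Finsupp.single mu 1 + Finsupp.single u 3 := hupd _ _ 1 3 rfl rfl
  have he2 : ((μ₀ + Finsupp.single (j k) 2).update (j k) (2 - 2)).update u (2 + 2) =
      Finsupp.single mu 1 + Finsupp.single u 4 := by
    rw [hupd _ _ 0 4 rfl rfl, Finsupp.single_zero, zero_add]
  rw [he0, he1, he2, coeff_divMonomial, coeff_divMonomial, coeff_divMonomial, hnf, hW] at hbirth
  -- `hbirth : _ * 0 + 3 * β * V + _ * 0 = 0`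
  have h3 : ((2 + 1 : ℕ).choose 1 : K) ≠ 0 := by
    rw [show (2 + 1 : ℕ).choose 1 = 3 by rfl]
    exact natCast_ne_zero_of_lt p (by norm_num) (by omega)
  have hkey : ((2 + 1 : ℕ).choose 1 : K) * b k u ^ 1 *
      coeff ((c k).r + (Finsupp.single (j k) 1 + Finsupp.single mu 1 + Finsupp.single u 3)) (c k).F = 0 := by
    have h := hbirth
    simp only [mul_zero, zero_add, add_zero] at h
    exact h
  rw [pow_one] at hkey
  rcases mul_eq_zero.mp hkey with h | h
  · rcases mul_eq_zero.mp h with h' | h'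
    · exact absurd h' h3
    · exact h'
  · exact absurd h hV

end Chain


end ResCone

end Summit.ResolutionOfSingularities.ResolutionOfSingularities.Theorems.PIDim4
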